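import Summits.RiemannHypothesis.RiemannHypothesis.Theses.LiDirichletAsymptotic
import Summits.RiemannHypothesis.RiemannHypothesis.Theorems.LiDirichletAsymptoticCharCount
import Summits.RiemannHypothesis.RiemannHypothesis.Theorems.LiCoefficientsLiWindowIdentity
import Summits.RiemannHypothesis.RiemannHypothesis.Theorems.LiAsymptoticSmoothReplace
import Literature.NumberTheory.LFunctions.DirichletLZeroCountingParityProfile
import HarnessLib

/-!
# RiemannHypothesis / LiDirichletAsymptotic — support S1χ `LiLowZerosChar`: the LOW ZEROS, counted trivially
# (RH-FREE · GRH-FREE)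

RH-FREE · GRH-FREE PROOF-OF-DATA (rung L-P(P1⁺χ)) [rh-li-prover].  Route `Theses/LiDirichletAsymptotic.lean`
(cell `pub/rh-li`), item `LiLowZerosChar` (stmt-RiemannHypothesis-19633): for `χ` primitive mod `q > 1` and
`n ≥ 900` (`a = √n ≥ 30`),

  `|charWeightTrace χ n √n − charCountMainExact χ √n| ≤ charErrLowP q n`, and `≤ charErrLowB q n` given BMOR Thm 1.1.

`0 ≤ Σ_{|γ|≤a} m f_n ≤ 2 N(a, χ)` (`f_n ∈ [0, 2]`); `N(a) ≤ M_exact(a) + argSRem q a + 0.014` (tree remainder at every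
height, `CharCount.abs_count_sub_exact_le_argSRem`) resp. `N(a) ≤ N_BMOR(a) + bmorRem q a − ¼` (the named fact, as a
HYPOTHESIS); and the two main terms agree to `O(1/a)`: `|M_exact(t) − (charCountMain q t − χ(−1)/4)| ≤ 0.9/t` from
the tree's explicit Stirling brackets for `θ₀ = θ` and `θ₁` (`abs_gammaArgPhase_sub_stirling_le`, below).
Nothing here bears on the truth of RH or GRH; `bmor2021_theorem11` is never used except as an assumption.
-/

noncomputable section

-- D-0017: `Summit.<S>.<S>.…` is the designed namespace of a single-problem summit.
set_option linter.dupNamespace false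

open MeasureTheory Set Filter

namespace Summit.RiemannHypothesis.RiemannHypothesis.Theorems.LiTheory

open Literature.NumberTheory.LFunctions Literature.NumberTheory.LFunctions.ExplicitPsiChar
open Literature.NumberTheory.LFunctions.DirichletTheta
open Literature.NumberTheory.LFunctions.DirichletDisc (zeroOrder)

namespace LowChar

variable {q : ℕ} [NeZero q] {χ : DirichletCharacter ℂ q}

/-! ### Stirling for the `Γ`-phase, both parities, with the `1/t` rate -/

/-- **`|θ_κ(t) − ((t/2) log(t/2π) − t/2 + (2κ−1)π/8)| ≤ 1.4/t`** for `κ ∈ {0, 1}`, `t ≥ 2` (the tree's explicit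
Stirling for `θ` with `2K(¼) ≤ 1.171`, transferred to `θ₁` by the parity profile; `1/(2 sinh πt) ≤ 1/(2πt)`). -/
theorem abs_gammaArgPhase_sub_stirling_le {κ : ℕ} (hκ : κ = 0 ∨ κ = 1) {t : ℝ} (ht : 2 ≤ t) :
    |gammaArgPhase κ t - (t / 2 * Real.log (t / (2 * Real.pi)) - t / 2 + (2 * (κ : ℝ) - 1) * Real.pi / 8)| ≤
      1.4 / t := by
  have hπ := Real.pi_gt_three
  have ht0 : 0 < t := by linarith
  have hK := Window.two_stirlingVertRate_le
  have hKt : 2 * stirlingVertRate (1 / 4) / t ≤ 1.171 / t := div_le_div_of_nonneg_right hK ht0.le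
  rcases hκ with h | h
  · subst h
    rw [gammaArgPhase_zero]
    have h0 := abs_riemannSiegelTheta_sub_stirling_le ht
    have e : t / 2 * Real.log (t / (2 * Real.pi)) - t / 2 + (2 * ((0 : ℕ) : ℝ) - 1) * Real.pi / 8 =
        t / 2 * Real.log (t / (2 * Real.pi)) - t / 2 - Real.pi / 8 := by push_cast; ring
    rw [e]
    refine h0.trans (hKt.trans ?_)
    exact div_le_div_of_nonneg_right (by norm_num) ht0.le
  · subst h
    have h0 := DirichletTheta.abs_gammaArgPhase_one_sub_stirling_le ht
    have e : t / 2 * Real.log (t / (2 * Real.pi)) - t / 2 + (2 * ((1 : ℕ) : ℝ) - 1) * Real.pi / 8 =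
        t / 2 * Real.log (t / (2 * Real.pi)) - t / 2 + Real.pi / 8 := by push_cast; ring
    rw [e]
    have hs : 1 / (2 * Real.sinh (Real.pi * t)) ≤ 0.2 / t := by
      have hx : Real.pi * t ≤ Real.sinh (Real.pi * t) := Real.self_le_sinh_iff.2 (by positivity)
      have hpos : 0 < Real.sinh (Real.pi * t) := by nlinarith
      rw [div_le_div_iff₀ (by positivity) ht0]
      nlinarith
    refine h0.trans ?_
    have : (1.171 : ℝ) / t + 0.2 / t ≤ 1.4 / t := by
      rw [← add_div]; exact div_le_div_of_nonneg_right (by norm_num) ht0.le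
    linarith

/-- **The exact main term vs the Riemann–von Mangoldt/BMOR main term**: for `t ≥ 2`, `q ≥ 1`,
`|charCountMainExact χ t − (charCountMain q t − χ(−1)/4)| ≤ 0.9/t` (`χ(−1) = (−1)^{charParity χ}`). -/
theorem abs_exact_sub_main_le (χ : DirichletCharacter ℂ q) {t : ℝ} (ht : 2 ≤ t) :
    |charCountMainExact χ t - (charCountMain q t - (-1 : ℝ) ^ charParity χ / 4)| ≤ 0.9 / t := by
  have hπ := Real.pi_gt_three
  have hπ0 := Real.pi_pos
  have ht0 : 0 < t := by linarith
  have hq : (0 : ℝ) < q := by exact_mod_cast Nat.pos_of_ne_zero (NeZero.ne q)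
  have hκ : charParity χ = 0 ∨ charParity χ = 1 := by
    rcases χ.even_or_odd with h | h
    · exact Or.inl (charParity_of_even h)
    · exact Or.inr (charParity_of_odd h)
  have hE := abs_gammaArgPhase_sub_stirling_le hκ ht
  have hlog : Real.log (q * t / (2 * Real.pi * Real.exp 1)) = Real.log q + Real.log (t / (2 * Real.pi)) - 1 := by
    rw [Real.log_div (by positivity) (by positivity), Real.log_mul hq.ne' ht0.ne',
      Real.log_mul (by positivity) (Real.exp_pos 1).ne', Real.log_exp, Real.log_div ht0.ne' (by positivity)]
    ring
  have hpar : (2 * (charParity χ : ℝ) - 1) / 4 + (-1 : ℝ) ^ charParity χ / 4 = 0 := by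
    rcases hκ with h | h <;> rw [h] <;> norm_num
  have e : charCountMainExact χ t - (charCountMain q t - (-1 : ℝ) ^ charParity χ / 4) =
      2 / Real.pi * (gammaArgPhase (charParity χ) t -
        (t / 2 * Real.log (t / (2 * Real.pi)) - t / 2 + (2 * (charParity χ : ℝ) - 1) * Real.pi / 8)) +
        ((2 * (charParity χ : ℝ) - 1) / 4 + (-1 : ℝ) ^ charParity χ / 4) := by
    unfold charCountMainExact charCountMain
    rw [hlog]
    field_simp
    ring
  rw [e, hpar, add_zero, abs_mul, abs_of_pos (by positivity)]
  calc 2 / Real.pi * |gammaArgPhase (charParity χ) t -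
        (t / 2 * Real.log (t / (2 * Real.pi)) - t / 2 + (2 * (charParity χ : ℝ) - 1) * Real.pi / 8)|
      ≤ 2 / Real.pi * (1.4 / t) := mul_le_mul_of_nonneg_left hE (by positivity)
    _ ≤ 0.9 / t := by
        rw [div_mul_div_comm, div_le_div_iff₀ (by positivity) ht0]
        have h314 := mul_lt_mul_of_pos_right Real.pi_gt_d2 ht0
        nlinarith

/-! ### The weight trace is between `0` and `2 N` -/

/-- `0 ≤ liWindowWeight₀ n t ≤ 2`. -/
theorem liWindowWeight₀_mem (n : ℕ) (t : ℝ) : 0 ≤ liWindowWeight₀ n t ∧ liWindowWeight₀ n t ≤ 2 := by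
  unfold liWindowWeight₀
  split_ifs with h
  · rcases neg_one_pow_eq_or ℝ n with h1 | h1 <;> rw [h1] <;> norm_num
  · exact SmoothReplace.liWindowWeight_mem n t

/-- `0 ≤ charWeightTrace χ n T ≤ 2 N(T, χ)`. -/
theorem charWeightTrace_mem (hχ1 : χ ≠ 1) (n : ℕ) (T : ℝ) :
    0 ≤ charWeightTrace χ n T ∧ charWeightTrace χ n T ≤ 2 * lfunctionZeroCount χ T := by
  classical
  have hfin := lfunctionZeroBox_finite hχ1 T
  unfold charWeightTrace
  rw [finsum_mem_eq_finite_toFinset_sum _ hfin, CharCount.count_eq_sum hχ1 T, Finset.mul_sum]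
  constructor
  · exact Finset.sum_nonneg fun ρ _ ↦ mul_nonneg (Nat.cast_nonneg _) (liWindowWeight₀_mem n _).1
  · refine Finset.sum_le_sum fun ρ _ ↦ ?_
    have hm : (0 : ℝ) ≤ zeroOrder χ ρ := Nat.cast_nonneg _
    have h2 := (liWindowWeight₀_mem n |ρ.im|).2
    nlinarith

/-! ### The BMOR count bound, from the named fact taken as a hypothesis -/

/-- `ℓ(q, t) > 1.567` for `q ≥ 2`, `t ≥ 30` (`q(t+2)/2π ≥ 64/2π > e²`). -/
theorem bmorEll_gt {q : ℕ} (hq : 1 < q) {t : ℝ} (ht : 30 ≤ t) : 1.567 < bmorEll q t := by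
  have hq2 : (2 : ℝ) ≤ q := by exact_mod_cast hq
  have hπ := Real.pi_lt_d2
  unfold bmorEll
  have hx : Real.exp 2 < q * (t + 2) / (2 * Real.pi) := by
    have he : Real.exp 2 < 7.4 := by
      have h1 := Real.exp_one_lt_d9
      have : Real.exp 2 = Real.exp 1 * Real.exp 1 := by rw [← Real.exp_add]; norm_num
      rw [this]; nlinarith [Real.exp_pos 1]
    rw [lt_div_iff₀ (by positivity)]
    have h64 : (64 : ℝ) ≤ q * (t + 2) := by nlinarith
    have hprod : Real.exp 2 * (2 * Real.pi) < 7.4 * 6.3 :=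
      mul_lt_mul'' he (by linarith) (Real.exp_pos 2).le (by positivity)
    linarith
  have := Real.log_lt_log (Real.exp_pos 2) hx
  rw [Real.log_exp] at this
  linarith

/-- Given BMOR Thm 1.1: `|N(t, χ) − (charCountMain q t − χ(−1)/4)| ≤ bmorRem q t − ¼` for `χ` primitive mod `q > 1`,
`t ≥ 30` (`bmorRem` carries the parity offset: it is `0.22737 ℓ + 2 log(1+ℓ) − 0.25`). -/
theorem abs_count_sub_main_le_of_bmor (hB : bmor2021_theorem11) (hq : 1 < q) (hχ : χ.IsPrimitive) {t : ℝ}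
    (ht : 30 ≤ t) :
    |(lfunctionZeroCount χ t : ℝ) - (charCountMain q t - (-1 : ℝ) ^ charParity χ / 4)| ≤ bmorRem q t - 1 / 4 := by
  have h := ((hB q hq χ hχ t (by linarith)).2) (bmorEll_gt hq ht)
  unfold bmorRem charCountMain
  have e : (0.22737 : ℝ) * bmorEll q t + 2 * Real.log (1 + bmorEll q t) - 0.25 - 1 / 4 =
      0.22737 * bmorEll q t + 2 * Real.log (1 + bmorEll q t) - 0.5 := by ring
  rw [e]
  exact h

end LowChar

open LowChar in
/-- **Support S1χ `LiLowZerosChar`** (stmt-RiemannHypothesis-19633; RH-FREE · GRH-FREE): for `χ` primitive mod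
`q > 1` and `n ≥ 900`, `|charWeightTrace χ n √n − charCountMainExact χ √n| ≤ charErrLowP q n`, and
`≤ charErrLowB q n` GIVEN `bmor2021_theorem11` (hypothesis only). -/
theorem liLowZerosChar_bound (q : ℕ) [NeZero q] (χ : DirichletCharacter ℂ q) (hχ : χ.IsPrimitive) (hq : 1 < q)
    (n : ℕ) (hn : 900 ≤ n) :
    |charWeightTrace χ n (Real.sqrt n) - charCountMainExact χ (Real.sqrt n)| ≤ charErrLowP q n ∧
      (bmor2021_theorem11 →
        |charWeightTrace χ n (Real.sqrt n) - charCountMainExact χ (Real.sqrt n)| ≤ charErrLowB q n) := by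
  have hχ1 : χ ≠ 1 := ne_one_of_isPrimitive hχ hq
  have hnR : (900 : ℝ) ≤ n := by exact_mod_cast hn
  unfold charErrLowP charErrLowB
  set a := Real.sqrt n with ha
  have ha30 : 30 ≤ a := by
    have h30 : Real.sqrt ((30 : ℝ) ^ 2) = 30 := Real.sqrt_sq (by norm_num)
    rw [ha, ← h30]
    exact Real.sqrt_le_sqrt (by linarith)
  have ha0 : 0 < a := by linarith
  obtain ⟨hW0, hW2⟩ := charWeightTrace_mem hχ1 n a
  have hMm := abs_le.1 (abs_exact_sub_main_le χ (show (2 : ℝ) ≤ a by linarith))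
  have h09 : (0.9 : ℝ) / a ≤ 0.03 := by rw [div_le_iff₀ ha0]; linarith
  have hκ : charParity χ = 0 ∨ charParity χ = 1 := by
    rcases χ.even_or_odd with h | h
    · exact Or.inl (charParity_of_even h)
    · exact Or.inr (charParity_of_odd h)
  have hsign : |(-1 : ℝ) ^ charParity χ / 4| ≤ 1 / 4 := by
    rcases hκ with h | h <;> rw [h] <;> norm_num
  obtain ⟨hs1, hs2⟩ := abs_le.1 hsign
  constructor
  · -- tree constants
    have hN := (abs_le.1 (CharCount.abs_count_sub_exact_le_argSRem hχ hq ha0)).2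
    have hrem0 : 0 ≤ argSRem q a := by
      unfold argSRem
      have hq2 : (2 : ℝ) ≤ q := by exact_mod_cast hq
      have : (1 : ℝ) ≤ 9.1902 * q * (a + 4) := by nlinarith
      have := Real.log_nonneg this
      positivity
    rw [abs_le]
    constructor <;> nlinarith
  · intro hB
    have hN := (abs_le.1 (abs_count_sub_main_le_of_bmor hB hq hχ ha30)).2
    have hrem0 : 0 ≤ bmorRem q a := by
      have hℓ := bmorEll_gt hq ha30
      unfold bmorRem
      have : 0 ≤ Real.log (1 + bmorEll q a) := Real.log_nonneg (by linarith)
      nlinarith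
    rw [abs_le]
    constructor <;> nlinarith

/-- **Item `LiLowZerosChar` of route `LiDirichletAsymptotic`** (stmt-RiemannHypothesis-19633), closed BY NAME. -/
theorem liLowZerosChar_proof :
    Summit.RiemannHypothesis.RiemannHypothesis.Theses.LiDirichletAsymptotic.LiLowZerosChar :=
  fun q _ χ hχ hq n hn ↦ liLowZerosChar_bound q χ hχ hq n hn

end Summit.RiemannHypothesis.RiemannHypothesis.Theorems.LiTheory

end
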